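import Literature.Analysis.FluidPDE.Tao2016AveragedNS.DelayCircuitHolds
import HarnessLib

/-!
# Tao 2016, §5.5 — retuning the gate: the delay is free, robustness is priced by IGNITION
# abruptness, and output abruptness is capped by the drain

T. Tao, *Finite time blowup for an averaged three-dimensional Navier–Stokes equation*, J. Amer.
Math. Soc. **29** (2016) 601–674 = arXiv:1402.0290, §5.3 (amplifier, explicit `tanh/sech`
solution), §5.5 (the five-mode delay circuit (5.5)/(5.6), Theorem 5.3 and the caricature (i)–(iv)
of its dynamics, p. 28: "`b` grows linearly like `εt`, `c` grows exponentially like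
`ε² exp((t²/2 - 1)K¹⁰)` … It is by no means the only circuit that can accomplish this task").
[`Tao2016AveragedNS`]

HONEST FRAMING (cell pub-fluidc, verbatim): *low prior, high value-of-information experiment on
Tao's machine paradigm; NOT a claim that NS blows up.* Everything in this file is finite-dimensional
ODE theory about Tao's TOY circuit (5.5) and a one-parameter re-tuning of it; nothing is asserted
about the Navier–Stokes equations.

## Why this file exists (cell pub-fluidc: DICTIONARY.md §13, ASSEMBLY.md §2j.5 "the design question")

The tree knows that ONE Tao gate is fragile at the scale of its seed `ε²e^{-K¹⁰}`
(`GateFragility`, `TriggerFragility`, `TriggerTolerance`, `GateCertificate`), and ASSEMBLY §2j.5 reads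
this as intrinsic to "arming an instability with a tiny seed": margin `≍ e^{-A}`, `A` = rate × delay.
This file separates WHAT in (5.5) is forced from what is TUNING, by making the exponent `K¹⁰` of the
amplifier coupling `ε⁻¹K¹⁰` and of the seed pump `ε²e^{-K¹⁰}` a free SHARPNESS parameter `M`:

  `delayCircuitWith K M ε` :  `∂ₜa = -ε⁻²cd - εab - ε²e^{-M}ac`, `∂ₜb = εa² - ε⁻¹Mc²`,
  `∂ₜc = ε²e^{-M}a² + ε⁻¹Mbc`, `∂ₜd = ε⁻²ca - Kdã`, `∂ₜã = Kd²`;   Tao's (5.5) is `M = K¹⁰`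
  (`delayCircuitWith_pow_ten`, by `rfl`). Same five gates (`delayCircuitWith_eq_gates`), same
  cancellation and energy identity.

What is proved (all elementary, all kernel-checked, no named facts):

* A. NO SELF-IGNITION (`IsCancelling.apply_single_self`): in ANY cancelling circuit a lone mode is
  stationary — `F (x·eᵢ) i = 0`. So a quiet trigger mode is driven LINEARLY by the loaded modes
  (plus designed seed pumps): while it is small its log-amplitude integrates a RATE that is a linear
  form in the loaded amplitudes, whose slew is bounded by the couplings. This is why the scalar
  model of part B is the right caricature of every single-mode trigger, not just of Tao's.
* B. THE SWEPT TRIGGER (Tao's caricature (i) made exact): `sweptTrigger M c₀ t = c₀·exp(Mt²/2)`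
  solves `c' = (Mt)·c` (`hasDerivAt_sweptTrigger`) — the amplifier `ε⁻¹M·b·c` swept by the CLOCK
  `b = εt` (the pump `a → b` is bounded-speed TRAVEL; the delay is made by the clock, not by the
  seed). It reaches a threshold `θ` at `ignitionTime M c₀ θ = √(2 log(θ/c₀)/M)`
  (`sweptTrigger_ignitionTime`, first hitting: `sweptTrigger_lt_of_lt_ignitionTime`), and WITH THE
  SEED `c₀ = θe^{-M}` THE DELAY IS `√2` FOR EVERY `M > 0` (`ignitionTime_seed`): Tao's `t_c = √2`
  does not need `K¹⁰`; any sharpness gives the same delay. The ignition rate at firing is `√2·M`,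
  so the ignition abruptness (rate × delay) is `A = 2M` — a FREE design parameter.
* C. THE PRICE, EXACTLY (`ignitionTime_seed_kick`, `ignitionTime_kick_le_one`,
  `sqrt_le_ignitionTime_kick`): a kick `κ ≥ 0` of the trigger re-times ignition to
  `√(2 - (2/M)·log(1 + κe^{M}/θ))`; it fires by time `1` (early by `≥ √2 - 1`, an order-one
  failure of Theorem 5.3's timing for `K ≥ 6`) as soon as `κ ≥ θe^{-M/2}`, and keeps the timing
  `≥ √(2 - 2η)` whenever `κ ≤ θe^{-M}(e^{Mη} - 1)` (the exact tolerance, by the closed form). In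
  words: ROBUSTNESS RADIUS = THRESHOLD × `e^{-A/2}` × `(e^{Aη/2} - 1)` — exponential in the IGNITION
  abruptness `A` one asks for, with timing slack `η`.
  Tao asks `A = 2K¹⁰`; his radius `θe^{-K¹⁰}` (`TriggerFragility`/`TriggerTolerance` bracket it by
  `e^{±O(K^{9.5})}`, which is the `e^{Aη/2}` factor at `η ≍ K^{-1/2}`) is this law, not an accident.
* D. THE LAW IS GENERAL (`log_growth_ge_of_slew`, `trigger_le_of_slew`, `linear_ratio_const`,
  `kicked_ge_iff`): for ANY positive solution of `y' = ρ(t)y` whose rate obeys the slew bound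
  `ρ(t) ≥ ρ_f - S(t_f - t)` before firing, `y(t_f - τ) ≤ y(t_f)·exp(-(ρ_f τ - Sτ²/2))` — the trigger
  is exponentially small shortly before it fires (optimally `≤ y(t_f)e^{-ρ_f²/(2S)}` at
  `τ = ρ_f/S`) — and by linearity a kicked copy `z` satisfies `z = (z(t₁)/y(t₁))·y`, so it reaches
  `θ` exactly when `y` reaches `θ·y(t₁)/z(t₁)`: any kick comparable to that exponentially small
  value re-times the gate. THE EXPONENT IS `ρ_f²/(2S) = ρ_f·τ*/2` WITH `τ* = ρ_f/S` THE RAMP TIME OF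
  THE RATE — rate × RAMP time, not rate × delay. Tao's clock is the linear ramp `b = εt` over the
  whole delay, so for (5.5) ramp time = delay and the exponent is `A/2`; a clock that is ITSELF a
  delayed step (quiet, then rising within `w ≪ delay`) has `τ* ≈ w` — part G.
* E. OUTPUT ABRUPTNESS IS CAPPED BY THE DRAIN (`output_deficit_ge`, `loading_time_ge`): along EVERY
  trajectory of `delayCircuitWith K M ε` of energy `≤ 1` (any `M`, any `ε`), `1 - ã(t) ≥
  (1 - ã(t₀))·e^{-2K(t - t₀)}`: the output cannot be loaded from `≤ 1/2` to `≥ 1 - θ` faster than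
  `log(1/(2θ))/(2K)`. So the width of the "abrupt transition" seen by the NEXT generation is
  `≳ log(1/θ)/K` whatever the ignition sharpness; Theorem 5.3's window `K^{-1/2}` is within a
  logarithm of this drain limit, and ignition sharpness beyond `A ≍ K·log` is invisible at the
  output — but is paid for in radius.
* F. WHY TAO'S `ε` IS TINY (`abs_le_log_of_le_sech`, `amplifierPulse_duration_le`): once `b` is
  exhausted the trigger is the explicit amplifier pulse `c = r·sech(ε⁻¹Mr(t - t_p))` of §5.3
  (`amplifierSolution`), of height `r ≈ √2·ε` and half-width `≤ log(2r/ℓ)/(ε⁻¹Mr)` above any level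
  `ℓ`; the rotor is fast (`ε⁻²c ≥ K`) only while `c ≥ ℓ = ε²K`, i.e. for `≲ √2·log(2√2/(εK))/M`, and
  the drain needs `≳ log(1/θ)/K` of fast rotation (E): `log(1/(εK)) ≳ M·log(1/θ)/K`. With `M = K¹⁰`
  this is Tao's "ε sufficiently small depending on K" (`ε ≤ e^{-cK⁹}`; the tree's proof uses
  `ε ≤ e^{-10K¹⁰}K^{-100}`), and it multiplies the radius `θe^{-M} = ε²K·e^{-M}` by another
  `e^{-20K¹⁰}`. With `M ≲ K` it asks nothing beyond `εK ≲ θ^{O(1)}`.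
* G. THE LOOPHOLE: CLOCKED TRIGGERS AND STAGED SHARPENING (`trigger_le_of_rate_le`,
  `trigger_ge_of_le_rate`, `clockedTrigger_lt_threshold`, `clockedTrigger_fires_by`,
  `sharpening_eq_two_mul_log`). In the swept model the SHARPENING RATIO (clock ramp time `t_f` : trigger
  e-fold time `1/ρ_f` at firing) is EXACTLY `2·log(θ/c₀)` — sharpening `2m` per stage costs seed ratio
  `e^{-m}`, whence Tao's `e^{-K¹⁰}` for sharpening `2K¹⁰` in ONE stage. But a trigger whose clock is
  itself a delayed STEP — rate `≤ δ` on `[0, t₁]` (quiet), `≥ ρ₁` from `t₁ + w` on (loaded) — fires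
  inside `[t₁, t₁ + w + m'/ρ₁]` from EVERY initial level in `[θe^{-m'}, θe^{-m}]` as soon as
  `δt₁ < m`: its kick tolerance `≈ θe^{-m}` is set by the clock's QUIETNESS `δt₁`, not by the final
  rate `ρ₁`, and its own rise is `ρ₁`-fast. Tao's toolbox makes such step clocks: a trigger pulse
  pumped into a LATCH (pump outputs are monotone, `pump_output_monotone`; (5.5)'s own `d → ã` is one).
  DESIGN ARITHMETIC (heuristic beyond the lemmas; numerics kit job j047717, `num/cascade.py`): a chain
  clock `b` ⇒ trigger `c₁` → latch `ℓ₁` ⇒ trigger `c₂` → latch `ℓ₂` ⇒ … ⇒ `ℓ_s` driving the rotor,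
  all quadratic energy-conserving gates, COMPOSES sharpening multiplicatively — `∏ⱼ 2mⱼ` after `s`
  stages — at seed ratios `e^{-mⱼ}` PER STAGE, with `mⱼ ≳ log(rotor gain · delay) = O(log(K/ε))`
  forced only by quietness. Output abruptness `K` would then cost `s ≍ log K / log log(K/ε)` stages of
  `2` modes each and radii POLYNOMIAL in `(ε, 1/K)`: a candidate answer YES to ASSEMBLY §2j.5 inside
  Tao's toolbox, to be confirmed or killed by the numerics and by a Theorem-5.3-type proof for `s = 2`
  (successor work; nothing of it is claimed here beyond the clocked-trigger lemmas).

## The price list (DICTIONARY.md §13; numerics: kit job j047533, `num/retune.py`, 5-mode ODE only)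

radius of ONE gate ≈ [threshold `ε²K`] × [`e^{-M}` = `e^{-A/2}`, ignition sharpness — TUNING above
`A ≍ K log K`, since the drain caps output abruptness (E)] × [the `ε`-smallness forced by tail-riding
when `M ≫ K` (F) — TUNING] × [Grönwall `e^{-2L}` of `GateBudget` — CERTIFICATION, removed by bp3's
reach layer]. Of ASSEMBLY §2i's `10^{-692}` everything but `e^{-O(K log K)}` is tuning or
certification; and a design whose handoff tolerates an order-one RELATIVE transition width
(`A = O(log(1/radius))`) has POLYNOMIAL radius `θ·(θ/r)^{A/2}`-type — inside Tao's own five-mode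
family (numerics: `M = 3…5`, `ε = 3·10⁻³`, `K = 16` transfer `≥ 0.9999` of the energy after a delay
`≈ 1.8` with width `≈ 0.4…0.6` and seed `4·10⁻⁷…6·10⁻⁸`). WHAT THIS DOES NOT DO: Theorem 5.3 is
proved in the tree only at `M = K¹⁰`; whether §6's induction (checkpoints with `K^{-10}` accuracies,
windows `K^{-1/2}`) closes with a drain-matched `M ≍ K log K`, or with a ramped (order-one width)
handoff, is OPEN — the second is a renormalisation fixed-point problem for the handoff profile, not
a one-gate statement — and whether the staged design of part G meets §6's handoff is equally OPEN.
Nothing here lowers the burden on the fluid side (`GatePhysics.defect`): a polynomial radius in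
rescaled units is still a CLASS-uniform forcing bound true NS has no reason to grant.

## References
* T. Tao, JAMS 29 (2016) 601–674, arXiv:1402.0290: §5.3 (amp), §5.5 (5.5)/(5.6), caricature
  (i)–(iv) p. 28, Theorem 5.3; §6.1 hierarchy `1 ≪ 1/ε₀ ≪ K ≪ 1/ε ≪ n₀`. [`Tao2016AveragedNS`]
* N. Berglund, B. Gentz, *Noise-Induced Phenomena in Slow–Fast Dynamical Systems* (Springer 2006),
  Ch. 2 (dynamic bifurcations, bifurcation delay and its destruction by perturbations) — the printed
  home of part D's law, as located by the cell's LITERATURE.md §A11. [doi:10.1007/1-84628-186-5]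
-/

noncomputable section

open Set Real
open scoped NNReal

namespace Literature.Analysis.FluidPDE.Tao2016AveragedNS

variable {m : ℕ}

/-! ## A. No self-ignition in a cancelling circuit -/

/-- **No self-ignition.** In a cancelling circuit (`∑ᵢ Fᵢ(X)Xᵢ = 0`) the vector field at a state
supported on ONE mode has no component along that mode: a lone mode is stationary, so a trigger
mode can only be driven by OTHER modes. [cite: Tao2016AveragedNS, §5 (g-cancel)] -/
theorem IsCancelling.apply_single_self {F : (Fin m → ℝ) → (Fin m → ℝ)} (hF : IsCancelling F)
    (i : Fin m) {x : ℝ} (hx : x ≠ 0) : F (Pi.single i x) i = 0 := by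
  have h := hF (Pi.single i x)
  have hsum : ∑ l, F (Pi.single i x) l * (Pi.single i x : Fin m → ℝ) l
      = F (Pi.single i x) i * x := by
    rw [Finset.sum_eq_single i]
    · simp
    · intro l _ hl
      simp [hl]
    · simp
  rw [hsum] at h
  exact (mul_eq_zero.1 h).resolve_right hx

/-! ## The retuned family `delayCircuitWith K M ε` (Tao: `M = K¹⁰`) -/

/-- **The retuned delay circuit**: (5.5) with the sharpness exponent `K¹⁰` of the amplifier coupling
and of the seed pump replaced by a free parameter `M`:
`∂ₜa = -ε⁻²cd - εab - ε²e^{-M}ac`, `∂ₜb = εa² - ε⁻¹Mc²`, `∂ₜc = ε²e^{-M}a² + ε⁻¹Mbc`,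
`∂ₜd = ε⁻²ca - Kdã`, `∂ₜã = Kd²`. [cite: Tao2016AveragedNS, §5.5 (5.5)] -/
def delayCircuitWith (K M ε : ℝ) (X : Fin 5 → ℝ) : Fin 5 → ℝ :=
  ![-((ε ^ 2)⁻¹ * X 2 * X 3) - ε * X 0 * X 1 - ε ^ 2 * Real.exp (-M) * X 0 * X 2,
    ε * X 0 ^ 2 - ε⁻¹ * M * X 2 ^ 2,
    ε ^ 2 * Real.exp (-M) * X 0 ^ 2 + ε⁻¹ * M * X 1 * X 2,
    (ε ^ 2)⁻¹ * X 2 * X 0 - K * X 3 * X 4,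
    K * X 3 ^ 2]

/-- Tao's (5.5) is the member `M = K¹⁰` of the family. [cite: Tao2016AveragedNS, §5.5 (5.5)] -/
theorem delayCircuitWith_pow_ten (K ε : ℝ) : delayCircuitWith K (K ^ 10) ε = delayCircuit K ε := rfl

/-- The retuned circuit is the superposition of the same five gates: pump `ε : a → b` (the CLOCK),
pump `ε²e^{-M} : a → c` (the SEED), amplifier `ε⁻¹M : b ⇒ c` (the swept TRIGGER), rotor
`ε⁻² : c ∘ (a,d)`, pump `K : d → ã` (the DRAIN). [cite: Tao2016AveragedNS, §5.5] -/
theorem delayCircuitWith_eq_gates (K M ε : ℝ) :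
    delayCircuitWith K M ε = pumpOn ε 0 1 + pumpOn (ε ^ 2 * Real.exp (-M)) 0 2 +
      amplifierOn (ε⁻¹ * M) 1 2 + rotorOn ((ε ^ 2)⁻¹) 0 3 2 + pumpOn K 3 4 := by
  funext X; ext l
  fin_cases l <;> simp [delayCircuitWith, pumpOn, amplifierOn, rotorOn] <;> ring

/-- Every member of the family cancels. [cite: Tao2016AveragedNS, §5.5] -/
theorem isCancelling_delayCircuitWith (K M ε : ℝ) : IsCancelling (delayCircuitWith K M ε) := by
  rw [delayCircuitWith_eq_gates]
  exact ((((isCancelling_pumpOn _ _ _).add (isCancelling_pumpOn _ _ _)).add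
    (isCancelling_amplifierOn _ _ _)).add (isCancelling_rotorOn _ _ _ _)).add
    (isCancelling_pumpOn _ _ _)

/-- Energy conservation along any trajectory of the retuned circuit.
[cite: Tao2016AveragedNS, §5.5 (energy-con)] -/
theorem delayCircuitWith_energy {K M ε : ℝ} {X : ℝ → Fin 5 → ℝ}
    (hX : ∀ t, HasDerivAt X (delayCircuitWith K M ε (X t)) t) (t t₀ : ℝ) :
    energy (X t) = energy (X t₀) :=
  energy_eq_of_isCancelling (isCancelling_delayCircuitWith K M ε) hX t t₀

/-- From the datum (5.6) the energy is `1` for every member of the family.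
[cite: Tao2016AveragedNS, §5.5 (energy-con)] -/
theorem delayCircuitWith_energy_init {K M ε : ℝ} {X : ℝ → Fin 5 → ℝ}
    (hX : ∀ t, HasDerivAt X (delayCircuitWith K M ε (X t)) t) (h0 : X 0 = delayInit) (t : ℝ) :
    energy (X t) = 1 := by
  rw [delayCircuitWith_energy hX t 0, h0]
  simp [energy, delayInit, Fin.sum_univ_five]

/-! ## B. The swept trigger: Tao's caricature (i) made exact; the delay `√2` is free -/

/-- **The swept trigger** `c₀·exp(Mt²/2)`: the trigger mode of the retuned circuit in caricature —
the amplifier `∂ₜc = ε⁻¹M·b·c` swept by the clock `b = εt`, i.e. `∂ₜc = (Mt)·c`, started from the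
level `c₀` the seed pump provides. [cite: Tao2016AveragedNS, §5.5 caricature (i)] -/
def sweptTrigger (M c₀ : ℝ) (t : ℝ) : ℝ := c₀ * Real.exp (M * t ^ 2 / 2)

/-- The swept trigger solves `c' = (Mt)·c`. [cite: Tao2016AveragedNS, §5.5 caricature (i)] -/
theorem hasDerivAt_sweptTrigger (M c₀ t : ℝ) :
    HasDerivAt (sweptTrigger M c₀) (M * t * sweptTrigger M c₀ t) t := by
  have h1 : HasDerivAt (fun s : ℝ => M * s ^ 2 / 2) (M * (2 * t) / 2) t := by
    have h := ((hasDerivAt_pow 2 t).const_mul M).div_const 2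
    simpa using h
  have h2 := (h1.exp).const_mul c₀
  refine h2.congr_deriv ?_
  simp only [sweptTrigger]
  ring

/-- The swept trigger at time `0` is the seed level. [folklore] -/
@[simp] theorem sweptTrigger_zero (M c₀ : ℝ) : sweptTrigger M c₀ 0 = c₀ := by
  simp [sweptTrigger]

/-- The swept trigger is positive when the seed is. [folklore] -/
theorem sweptTrigger_pos {M c₀ : ℝ} (hc : 0 < c₀) (t : ℝ) : 0 < sweptTrigger M c₀ t :=
  mul_pos hc (Real.exp_pos _)

/-- The swept trigger is strictly increasing in `t ≥ 0` (for `M > 0`, `c₀ > 0`). [folklore] -/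
theorem sweptTrigger_strictMonoOn {M c₀ : ℝ} (hM : 0 < M) (hc : 0 < c₀) :
    StrictMonoOn (sweptTrigger M c₀) (Ici 0) := by
  intro s hs t _ hst
  unfold sweptTrigger
  refine mul_lt_mul_of_pos_left (Real.exp_lt_exp.2 ?_) hc
  have : s ^ 2 < t ^ 2 := by
    have hs0 : 0 ≤ s := hs
    nlinarith
  have := mul_lt_mul_of_pos_left this hM
  linarith

/-- **Ignition time** of the swept trigger from seed level `c₀` to threshold `θ`:
`√(2·log(θ/c₀)/M)`. [cite: Tao2016AveragedNS, §5.5 caricature (ii)] -/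
def ignitionTime (M c₀ θ : ℝ) : ℝ := Real.sqrt (2 * Real.log (θ / c₀) / M)

/-- The ignition time is nonnegative. [folklore] -/
theorem ignitionTime_nonneg (M c₀ θ : ℝ) : 0 ≤ ignitionTime M c₀ θ := Real.sqrt_nonneg _

/-- At the ignition time the swept trigger is exactly at threshold.
[cite: Tao2016AveragedNS, §5.5 caricature (ii)] -/
theorem sweptTrigger_ignitionTime {M c₀ θ : ℝ} (hM : 0 < M) (hc : 0 < c₀) (hcθ : c₀ ≤ θ) :
    sweptTrigger M c₀ (ignitionTime M c₀ θ) = θ := by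
  have hθ : 0 < θ := hc.trans_le hcθ
  have hlog : 0 ≤ Real.log (θ / c₀) := Real.log_nonneg ((one_le_div hc).2 hcθ)
  have harg : 0 ≤ 2 * Real.log (θ / c₀) / M := by positivity
  unfold sweptTrigger ignitionTime
  rw [Real.sq_sqrt harg]
  have : M * (2 * Real.log (θ / c₀) / M) / 2 = Real.log (θ / c₀) := by
    field_simp
  rw [this, Real.exp_log (div_pos hθ hc)]
  field_simp

/-- Before the ignition time the swept trigger is below threshold: `ignitionTime` is the FIRST
hitting time of `θ`. [cite: Tao2016AveragedNS, §5.5 caricature (i)] -/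
theorem sweptTrigger_lt_of_lt_ignitionTime {M c₀ θ t : ℝ} (hM : 0 < M) (hc : 0 < c₀)
    (hcθ : c₀ ≤ θ) (ht0 : 0 ≤ t) (ht : t < ignitionTime M c₀ θ) :
    sweptTrigger M c₀ t < θ := by
  have h := sweptTrigger_strictMonoOn hM hc ht0 (ignitionTime_nonneg M c₀ θ) ht
  rwa [sweptTrigger_ignitionTime hM hc hcθ] at h

/-- **The delay is free.** With Tao's seed `c₀ = θ·e^{-M}` the ignition time is `√2` for EVERY
sharpness `M > 0`: the exponent of the seed and of the amplifier cancel, exactly as `K¹⁰` does in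
`ε² exp((t²/2 - 1)K¹⁰)`. [cite: Tao2016AveragedNS, §5.5 caricature (i)–(ii), `t_c ≈ √2`] -/
theorem ignitionTime_seed {M θ : ℝ} (hM : 0 < M) (hθ : 0 < θ) :
    ignitionTime M (θ * Real.exp (-M)) θ = Real.sqrt 2 := by
  unfold ignitionTime
  have h1 : θ / (θ * Real.exp (-M)) = Real.exp M := by
    rw [Real.exp_neg]
    field_simp
  rw [h1, Real.log_exp]
  congr 1
  field_simp

/-- Tao's seed is below threshold. [folklore] -/
theorem seed_le_threshold {M θ : ℝ} (hM : 0 ≤ M) (hθ : 0 ≤ θ) : θ * Real.exp (-M) ≤ θ := by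
  have : Real.exp (-M) ≤ 1 := Real.exp_le_one_iff.2 (by linarith)
  nlinarith

/-! ## C. The price, exactly: kicks of the swept trigger -/

/-- **Kicked ignition time, closed form.** A kick `κ ≥ 0` added to Tao's seed re-times the
ignition to `√(2 - (2/M)·log(1 + κe^{M}/θ))`. [cite: Tao2016AveragedNS, §5.5 caricature (i)–(ii)] -/
theorem ignitionTime_seed_kick {M θ κ : ℝ} (hM : 0 < M) (hθ : 0 < θ) (hκ : 0 ≤ κ) :
    ignitionTime M (θ * Real.exp (-M) + κ) θ
      = Real.sqrt (2 - 2 * Real.log (1 + κ * Real.exp M / θ) / M) := by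
  unfold ignitionTime
  have hE : 0 < Real.exp M := Real.exp_pos M
  have hq : 0 < 1 + κ * Real.exp M / θ := by positivity
  have h1 : θ / (θ * Real.exp (-M) + κ) = Real.exp M / (1 + κ * Real.exp M / θ) := by
    rw [Real.exp_neg]
    field_simp
  rw [h1, Real.log_div hE.ne' hq.ne', Real.log_exp]
  congr 1
  field_simp

/-- **Threshold side.** A kick `κ ≥ θe^{-M/2}` — still exponentially small, `e^{M/2}` times the
seed — makes the swept trigger fire by time `1`, i.e. EARLY by at least `√2 - 1 > 0.41`, outside
Theorem 5.3's window `t_c - K^{-1/2}` for every `K ≥ 6`. (Earliness `≍ K^{-1/2}` — leaving the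
window at all — already happens at `κ = seed·e^{O(K^{9.5})}` when `M = K¹⁰`: the contrapositive of
`sqrt_le_ignitionTime_kick` below with `η ≍ K^{-1/2}`, and `TriggerFragility.kickThreshold` for the
true circuit.)
[cite: Tao2016AveragedNS, §5.5 Theorem 5.3 (tcable)] -/
theorem ignitionTime_kick_le_one {M θ κ : ℝ} (hM : 0 < M) (hθ : 0 < θ) (hκ0 : 0 ≤ κ)
    (hκ : θ * Real.exp (-(M / 2)) ≤ κ) :
    ignitionTime M (θ * Real.exp (-M) + κ) θ ≤ 1 := by
  rw [ignitionTime_seed_kick hM hθ hκ0]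
  have hE : 0 < Real.exp M := Real.exp_pos M
  -- `1 + κ e^M/θ ≥ e^{M/2}`
  have hk : Real.exp (M / 2) ≤ 1 + κ * Real.exp M / θ := by
    have h1 : Real.exp (M / 2) = θ * Real.exp (-(M / 2)) * Real.exp M / θ := by
      rw [mul_assoc, ← Real.exp_add, show -(M / 2) + M = M / 2 by ring]
      field_simp
    have h2 : θ * Real.exp (-(M / 2)) * Real.exp M / θ ≤ κ * Real.exp M / θ := by
      apply div_le_div_of_nonneg_right _ hθ.le
      exact mul_le_mul_of_nonneg_right hκ hE.le
    linarith
  have hlog : M / 2 ≤ Real.log (1 + κ * Real.exp M / θ) := by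
    have := Real.log_le_log (Real.exp_pos (M / 2)) hk
    rwa [Real.log_exp] at this
  have harg : 2 - 2 * Real.log (1 + κ * Real.exp M / θ) / M ≤ 1 := by
    have : 1 ≤ 2 * Real.log (1 + κ * Real.exp M / θ) / M := by
      rw [le_div_iff₀ hM]
      linarith
    linarith
  calc Real.sqrt (2 - 2 * Real.log (1 + κ * Real.exp M / θ) / M)
      ≤ Real.sqrt 1 := Real.sqrt_le_sqrt harg
    _ = 1 := Real.sqrt_one

/-- **Tolerance side.** A kick `κ ≤ θe^{-M}(e^{Mη} - 1)` — at most `(e^{Mη} - 1)` seeds — keeps the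
ignition time `≥ √(2 - 2η)`. For the timing slack `η ≍ K^{-1/2}` of Theorem 5.3 this is the swept
model's version of `TriggerTolerance` (`kickTolerance = seed·e^{K^{9.5}/4}` at `M = K¹⁰`).
[cite: Tao2016AveragedNS, §5.5 Theorem 5.3 (tcable)] -/
theorem sqrt_le_ignitionTime_kick {M θ κ η : ℝ} (hM : 0 < M) (hθ : 0 < θ) (hκ0 : 0 ≤ κ)
    (hκ : κ ≤ θ * Real.exp (-M) * (Real.exp (M * η) - 1)) :
    Real.sqrt (2 - 2 * η) ≤ ignitionTime M (θ * Real.exp (-M) + κ) θ := by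
  rw [ignitionTime_seed_kick hM hθ hκ0]
  have hE : 0 < Real.exp M := Real.exp_pos M
  have hq : 0 < 1 + κ * Real.exp M / θ := by positivity
  -- `1 + κ e^M/θ ≤ e^{Mη}`
  have hk : 1 + κ * Real.exp M / θ ≤ Real.exp (M * η) := by
    have h1 : κ * Real.exp M / θ ≤ θ * Real.exp (-M) * (Real.exp (M * η) - 1) * Real.exp M / θ := by
      apply div_le_div_of_nonneg_right _ hθ.le
      exact mul_le_mul_of_nonneg_right hκ hE.le
    have h2 : θ * Real.exp (-M) * (Real.exp (M * η) - 1) * Real.exp M / θ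
        = Real.exp (M * η) - 1 := by
      have : Real.exp (-M) * Real.exp M = 1 := by rw [← Real.exp_add]; simp
      calc θ * Real.exp (-M) * (Real.exp (M * η) - 1) * Real.exp M / θ
          = (Real.exp (-M) * Real.exp M) * (Real.exp (M * η) - 1) * (θ / θ) := by ring
        _ = Real.exp (M * η) - 1 := by rw [this, div_self hθ.ne']; ring
    linarith
  have hlog : Real.log (1 + κ * Real.exp M / θ) ≤ M * η := by
    have := Real.log_le_log hq hk
    rwa [Real.log_exp] at this
  apply Real.sqrt_le_sqrt
  have : 2 * Real.log (1 + κ * Real.exp M / θ) / M ≤ 2 * η := by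
    rw [div_le_iff₀ hM]
    nlinarith
  linarith

/-- The seed-relative tolerance `e^{Mη} - 1` is at least `Mη`: in units of the seed the radius is
LINEAR in the sharpness and in the timing slack; in absolute units it is `θ·e^{-M}·(e^{Mη} - 1)`,
exponentially small in the ignition abruptness `A = 2M`. [folklore] -/
theorem mul_eta_le_tolerance {M θ η : ℝ} (hθ : 0 ≤ θ) :
    θ * Real.exp (-M) * (M * η) ≤ θ * Real.exp (-M) * (Real.exp (M * η) - 1) := by
  apply mul_le_mul_of_nonneg_left _ (mul_nonneg hθ (Real.exp_pos _).le)
  linarith [Real.add_one_le_exp (M * η)]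

/-! ## D. The law is general: slew-limited rates force an exponentially small trigger before firing -/

/-- **Log-growth under a slew bound.** If `Φ' = ρ` and the rate obeys `ρ(t) ≥ ρ_f - S(t_f - t)` on
`[t_f - τ, t_f]`, then `Φ(t_f) - Φ(t_f - τ) ≥ ρ_f τ - Sτ²/2`. [folklore] -/
theorem log_growth_ge_of_slew {Φ ρ : ℝ → ℝ} {t_f τ ρ_f S : ℝ} (hτ : 0 ≤ τ)
    (hΦ : ∀ t, HasDerivAt Φ (ρ t) t)
    (hslew : ∀ t ∈ Icc (t_f - τ) t_f, ρ_f - S * (t_f - t) ≤ ρ t) :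
    ρ_f * τ - S * τ ^ 2 / 2 ≤ Φ t_f - Φ (t_f - τ) := by
  -- comparison primitive `Ψ(t) = ρ_f t + S (t_f - t)²/2`, `Ψ' = ρ_f - S (t_f - t)`
  have hΨ : ∀ t ∈ Icc (t_f - τ) t_f,
      HasDerivAt (fun s => ρ_f * s + S * (t_f - s) ^ 2 / 2) (ρ_f - S * (t_f - t)) t := by
    intro t _
    have h1 : HasDerivAt (fun s : ℝ => ρ_f * s) (ρ_f * 1) t := (hasDerivAt_id' t).const_mul ρ_f
    have h2 : HasDerivAt (fun s : ℝ => S * (t_f - s) ^ 2 / 2)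
        (S * (2 * (t_f - t) * (-1)) / 2) t := by
      have := (((hasDerivAt_id' t).const_sub t_f).pow 2).const_mul S |>.div_const 2
      simpa using this
    refine (h1.add h2).congr_deriv ?_
    ring
  have hmono := Thm53.monotoneOn_sub_of_le_deriv (convex_Icc (t_f - τ) t_f)
    (fun t _ => hΦ t) hΨ hslew
  have hmem1 : t_f - τ ∈ Icc (t_f - τ) t_f := ⟨le_rfl, by linarith⟩
  have hmem2 : t_f ∈ Icc (t_f - τ) t_f := ⟨by linarith, le_rfl⟩
  have h := hmono hmem1 hmem2 (by linarith)
  simp only at h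
  nlinarith [h]

/-- **Slew–seed lemma.** A positive solution of the linear trigger equation `y' = ρ(t)·y` whose rate
obeys the slew bound `ρ(t) ≥ ρ_f - S(t_f - t)` on `[t_f - τ, t_f]` satisfies
`y(t_f - τ) ≤ y(t_f)·exp(-(ρ_f τ - Sτ²/2))`: an abruptly igniting trigger is exponentially small
shortly before it fires. [cite: Tao2016AveragedNS, §5.3 (y-gronwall)] -/
theorem trigger_le_of_slew {y ρ : ℝ → ℝ} {t_f τ ρ_f S : ℝ} (hτ : 0 ≤ τ)
    (hy : ∀ t, HasDerivAt y (ρ t * y t) t) (hpos : ∀ t, 0 < y t)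
    (hslew : ∀ t ∈ Icc (t_f - τ) t_f, ρ_f - S * (t_f - t) ≤ ρ t) :
    y (t_f - τ) ≤ y t_f * Real.exp (-(ρ_f * τ - S * τ ^ 2 / 2)) := by
  have hlog : ∀ t, HasDerivAt (fun s => Real.log (y s)) (ρ t) t := by
    intro t
    have h := (hy t).log (hpos t).ne'
    refine h.congr_deriv ?_
    field_simp [(hpos t).ne']
  have hg := log_growth_ge_of_slew hτ hlog hslew
  have h1 : Real.log (y (t_f - τ)) ≤ Real.log (y t_f) + -(ρ_f * τ - S * τ ^ 2 / 2) := by linarith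
  calc y (t_f - τ) = Real.exp (Real.log (y (t_f - τ))) := (Real.exp_log (hpos _)).symm
    _ ≤ Real.exp (Real.log (y t_f) + -(ρ_f * τ - S * τ ^ 2 / 2)) := Real.exp_le_exp.2 h1
    _ = y t_f * Real.exp (-(ρ_f * τ - S * τ ^ 2 / 2)) := by
        rw [Real.exp_add, Real.exp_log (hpos _)]

/-- The optimal look-back `τ = ρ_f/S`: the trigger is `≤ y(t_f)·e^{-ρ_f²/(2S)}` at time `t_f - ρ_f/S`.
For Tao's gate (`S = K¹⁰`, `ρ_f = √2K¹⁰`, `t_f = √2`) this is `e^{-K¹⁰}` at time `0` — the seed.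
[cite: Tao2016AveragedNS, §5.5 caricature (i)] -/
theorem trigger_le_of_slew_opt {y ρ : ℝ → ℝ} {t_f ρ_f S : ℝ} (hS : 0 < S) (hρ : 0 ≤ ρ_f)
    (hy : ∀ t, HasDerivAt y (ρ t * y t) t) (hpos : ∀ t, 0 < y t)
    (hslew : ∀ t ∈ Icc (t_f - ρ_f / S) t_f, ρ_f - S * (t_f - t) ≤ ρ t) :
    y (t_f - ρ_f / S) ≤ y t_f * Real.exp (-(ρ_f ^ 2 / (2 * S))) := by
  have h := trigger_le_of_slew (div_nonneg hρ hS.le) hy hpos hslew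
  have : ρ_f * (ρ_f / S) - S * (ρ_f / S) ^ 2 / 2 = ρ_f ^ 2 / (2 * S) := by
    field_simp
    ring
  rwa [this] at h

/-- **Linearity.** Two solutions of the same linear trigger equation `y' = ρ(t)y`, `y` non-vanishing,
have constant ratio: `z(t) = (z(t₁)/y(t₁))·y(t)`. A kick `κ` at time `t₁` therefore multiplies the
whole future of the trigger by `1 + κ/y(t₁)`. [folklore] -/
theorem linear_ratio_const {y z ρ : ℝ → ℝ} (hy : ∀ t, HasDerivAt y (ρ t * y t) t)
    (hz : ∀ t, HasDerivAt z (ρ t * z t) t) (hne : ∀ t, y t ≠ 0) (t₁ t : ℝ) :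
    z t = z t₁ / y t₁ * y t := by
  have hq : ∀ s, HasDerivAt (fun r => z r / y r) 0 s := by
    intro s
    refine ((hz s).div (hy s) (hne s)).congr_deriv ?_
    have := hne s
    field_simp
    ring
  have hconst : z t / y t = z t₁ / y t₁ :=
    is_const_of_deriv_eq_zero (f := fun r => z r / y r)
      (fun s => (hq s).differentiableAt) (fun s => (hq s).deriv) t t₁
  calc z t = z t / y t * y t := by field_simp [hne t]
    _ = z t₁ / y t₁ * y t := by rw [hconst]

/-- **Re-timing by a kick, exactly.** With `y, z > 0` solving the same linear trigger equation,
`z` is at least the threshold `θ` at time `t` iff `y` is at least `θ·y(t₁)/z(t₁)` there: a kicked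
trigger (`z(t₁) = y(t₁) + κ`) fires exactly when the unkicked one reaches the LOWER level
`θ·y(t₁)/(y(t₁) + κ)` — so every kick comparable to the (by `trigger_le_of_slew`, exponentially
small) pre-firing value `y(t₁)` re-times the gate by order one. [folklore] -/
theorem kicked_ge_iff {y z ρ : ℝ → ℝ} (hy : ∀ t, HasDerivAt y (ρ t * y t) t)
    (hz : ∀ t, HasDerivAt z (ρ t * z t) t) (hypos : ∀ t, 0 < y t) {t₁ : ℝ} (hz₁ : 0 < z t₁)
    (θ t : ℝ) :
    θ ≤ z t ↔ θ * y t₁ / z t₁ ≤ y t := by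
  rw [linear_ratio_const hy hz (fun s => (hypos s).ne') t₁ t]
  have hy₁ := hypos t₁
  rw [div_mul_eq_mul_div, le_div_iff₀ hy₁, div_le_iff₀ hz₁]
  constructor <;> intro h <;> nlinarith [h]

/-! ## E. Output abruptness is capped by the drain (every trajectory, every `M`, every `ε`) -/

namespace DelayWith

variable {K M ε : ℝ} {X : ℝ → Fin 5 → ℝ}

/-- Componentwise derivative of the output mode `ã = X 4`: `∂ₜã = Kd²`.
[cite: Tao2016AveragedNS, §5.5 (ta-eq)] -/
theorem hasDerivAt_e (hX : ∀ t, HasDerivAt X (delayCircuitWith K M ε (X t)) t) (t : ℝ) :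
    HasDerivAt (fun s => X s 4) (K * X t 3 ^ 2) t := by
  have h := (hasDerivAt_pi.1 (hX t)) 4
  simpa [delayCircuitWith] using h

/-- Along a trajectory of energy `≤ 1`, `d² ≤ 1 - ã²`. [cite: Tao2016AveragedNS, §5.5 (energy-con)] -/
theorem d_sq_le {t : ℝ} (hE : energy (X t) ≤ 1) : X t 3 ^ 2 ≤ 1 - X t 4 ^ 2 := by
  have h : energy (X t) = X t 0 ^ 2 + X t 1 ^ 2 + X t 2 ^ 2 + X t 3 ^ 2 + X t 4 ^ 2 := by
    simp [energy, Fin.sum_univ_five]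
  nlinarith [sq_nonneg (X t 0), sq_nonneg (X t 1), sq_nonneg (X t 2)]

/-- **The drain cannot load the output faster than rate `2K`.** Along every trajectory of
`delayCircuitWith K M ε` (`K ≥ 0`) with energy `≤ 1`, for `t₀ ≤ t`:
`1 - ã(t) ≥ (1 - ã(t₀))·e^{-2K(t - t₀)}`. Only `∂ₜã = Kd² ≤ K(1 - ã²) ≤ 2K(1 - ã)` is used.
[cite: Tao2016AveragedNS, §5.5 (ta-eq), (energy-con)] -/
theorem output_deficit_ge (hK : 0 ≤ K) (hX : ∀ t, HasDerivAt X (delayCircuitWith K M ε (X t)) t)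
    (hE : ∀ t, energy (X t) ≤ 1) {t₀ t : ℝ} (ht : t₀ ≤ t) :
    (1 - X t₀ 4) * Real.exp (-(2 * K) * (t - t₀)) ≤ 1 - X t 4 := by
  -- `u = 1 - ã` satisfies `u' = -K d² ≥ -2K u`; integrating factor `e^{2Kt}`.
  have hu : ∀ s, HasDerivAt (fun r => 1 - X r 4) (-(K * X s 3 ^ 2)) s := fun s =>
    (hasDerivAt_e hX s).const_sub 1
  have hle1 : ∀ s, X s 4 ≤ 1 := by
    intro s
    have := d_sq_le (X := X) (t := s) (hE s)
    nlinarith [sq_nonneg (X s 3), sq_nonneg (X s 4 - 1)]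
  have hmono := Thm53.monotoneOn_intFactor (s := univ) (f := fun r => 1 - X r 4)
    (f' := fun s => -(K * X s 3 ^ 2)) (g := fun _ => -(2 * K)) (G := fun s => -(2 * K) * s)
    (φ := fun _ => 0) (Φ := fun _ => 0) convex_univ (fun s _ => hu s)
    (fun s _ => by simpa using (hasDerivAt_id' s).const_mul (-(2 * K)))
    (fun s _ => hasDerivAt_const s (0 : ℝ)) ?_
  · have h := hmono (mem_univ t₀) (mem_univ t) ht
    simp only [sub_zero, neg_mul, neg_neg] at h
    -- h : (1 - X t₀ 4) * exp (2K t₀) ≤ (1 - X t 4) * exp (2K t)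
    have hexp : Real.exp (-(2 * K) * (t - t₀)) = Real.exp (2 * K * t₀) / Real.exp (2 * K * t) := by
      rw [← Real.exp_sub]; congr 1; ring
    rw [hexp, mul_div_assoc']
    rw [div_le_iff₀ (Real.exp_pos _)]
    exact h
  · intro s _
    have hd := d_sq_le (X := X) (t := s) (hE s)
    have h4 := hle1 s
    have hpos : 0 < Real.exp (-(-(2 * K) * s)) := Real.exp_pos _
    have key : 0 ≤ -(K * X s 3 ^ 2) - -(2 * K) * (1 - X s 4) := by
      nlinarith [mul_nonneg hK (sub_nonneg.2 h4), sq_nonneg (X s 4 - 1),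
        mul_le_mul_of_nonneg_left hd hK]
    simpa using mul_nonneg key hpos.le

/-- **Loading time.** If the output holds at most half the energy at `t₀` (`ã(t₀) ≤ 1/2`) and at
least `1 - θ` of the amplitude at `t ≥ t₀` (`ã(t) ≥ 1 - θ`; necessarily `θ > 0`), then
`t - t₀ ≥ log(1/(2θ))/(2K)`: the "abrupt transition" delivered to the next generation has width
`≳ log(1/θ)/K`, whatever the ignition sharpness `M`. [cite: Tao2016AveragedNS, §5.5 caricature (iii)–(iv)] -/
theorem loading_time_ge (hK : 0 < K) (hX : ∀ t, HasDerivAt X (delayCircuitWith K M ε (X t)) t)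
    (hE : ∀ t, energy (X t) ≤ 1) {t₀ t θ : ℝ} (ht : t₀ ≤ t)
    (h₀ : X t₀ 4 ≤ 1 / 2) (h₁ : 1 - θ ≤ X t 4) :
    Real.log (1 / (2 * θ)) / (2 * K) ≤ t - t₀ := by
  have h := output_deficit_ge hK.le hX hE ht
  have hθ' : (1 / 2) * Real.exp (-(2 * K) * (t - t₀)) ≤ θ := by
    have : (1 / 2) * Real.exp (-(2 * K) * (t - t₀)) ≤ (1 - X t₀ 4) * Real.exp (-(2 * K) * (t - t₀)) :=
      mul_le_mul_of_nonneg_right (by linarith) (Real.exp_pos _).le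
    linarith
  -- `exp(-2K(t-t₀)) ≤ 2θ` ⇒ `log(1/(2θ)) ≤ 2K(t - t₀)`
  have h2 : Real.exp (-(2 * K) * (t - t₀)) ≤ 2 * θ := by linarith
  have h3 : Real.log (1 / (2 * θ)) ≤ 2 * K * (t - t₀) := by
    have hlog := Real.log_le_log (Real.exp_pos _) h2
    rw [Real.log_exp] at hlog
    rw [one_div, Real.log_inv]
    linarith
  rw [div_le_iff₀ (by linarith)]
  linarith

end DelayWith

/-! ## F. Why Tao's `ε` is tiny: the amplifier pulse is short -/

/-- `sech` bound: if `ℓ ≤ A·sech x` with `ℓ > 0` then `|x| ≤ log(2A/ℓ)`. [folklore] -/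
theorem abs_le_log_of_le_sech {A ℓ x : ℝ} (hℓ : 0 < ℓ) (h : ℓ ≤ A * (Real.cosh x)⁻¹) :
    |x| ≤ Real.log (2 * A / ℓ) := by
  have hc : 0 < Real.cosh x := Real.cosh_pos x
  have h1 : ℓ * Real.cosh x ≤ A := by
    have := mul_le_mul_of_nonneg_right h hc.le
    rwa [mul_assoc, inv_mul_cancel₀ hc.ne', mul_one] at this
  have h2 : Real.exp |x| ≤ 2 * Real.cosh x := by
    rw [Real.cosh_eq]
    rcases le_or_gt 0 x with hx | hx
    · rw [abs_of_nonneg hx]; linarith [Real.exp_pos (-x)]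
    · rw [abs_of_neg hx]; linarith [Real.exp_pos x]
  have h3 : Real.exp |x| ≤ 2 * A / ℓ := by
    rw [le_div_iff₀ hℓ]
    nlinarith
  have h4 : 0 < 2 * A / ℓ := lt_of_lt_of_le (Real.exp_pos _) h3
  rw [← Real.log_exp |x|]
  exact Real.log_le_log (Real.exp_pos _) h3

/-- **Pulse duration.** On the explicit amplifier trajectory of §5.3 with coupling `α > 0` and
amplitude `A > 0` — output `y(t) = A·sech(αA(T - t))`, which is the trigger `c` of (5.5) once the
clock `b` is exhausted (`α = ε⁻¹M`, `A ≈ √2·ε`) — the output exceeds a level `ℓ > 0` only for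
`|T - t| ≤ log(2A/ℓ)/(αA)`. With `ℓ = ε²K` (rotor speed `ε⁻²c ≥ K`) the rotor is fast for at most
`≈ √2·log(2√2/(εK))/M`, while the drain needs `≳ log(1/θ)/K` (`DelayWith.loading_time_ge`): hence
`log(1/(εK)) ≳ M·log(1/θ)/K`, Tao's "ε sufficiently small depending on K" when `M = K¹⁰`.
[cite: Tao2016AveragedNS, §5.3 (amp), §5.5 caricature (iii)] -/
theorem amplifierPulse_duration_le {α A T t ℓ : ℝ} (hα : 0 < α) (hA : 0 < A) (hℓ : 0 < ℓ)
    (h : ℓ ≤ amplifierSolution α A T t 1) : |T - t| ≤ Real.log (2 * A / ℓ) / (α * A) := by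
  have h' : ℓ ≤ A * (Real.cosh (α * A * (T - t)))⁻¹ := by
    simpa [amplifierSolution] using h
  have h1 := abs_le_log_of_le_sech hℓ h'
  rw [abs_mul, abs_of_pos (mul_pos hα hA)] at h1
  rw [le_div_iff₀ (mul_pos hα hA)]
  linarith

/-! ## G. The loophole: clocked triggers (quiet clock ⇒ no premature ignition; loaded clock ⇒
ignition within the clock's width), and the sharpening law `2·log(θ/c₀)` per stage -/

/-- Log-growth upper bound: `Φ' = ρ ≤ ρmax` on `[t₀, t₁]` gives `Φ t₁ - Φ t₀ ≤ ρmax·(t₁ - t₀)`.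
[folklore] -/
theorem log_growth_le {Φ ρ : ℝ → ℝ} {t₀ t₁ ρmax : ℝ} (ht : t₀ ≤ t₁)
    (hΦ : ∀ t, HasDerivAt Φ (ρ t) t) (hρ : ∀ t ∈ Icc t₀ t₁, ρ t ≤ ρmax) :
    Φ t₁ - Φ t₀ ≤ ρmax * (t₁ - t₀) := by
  have hΨ : ∀ t ∈ Icc t₀ t₁, HasDerivAt (fun s : ℝ => ρmax * s) ρmax t := fun t _ => by
    simpa using (hasDerivAt_id' t).const_mul ρmax
  have hanti := Thm53.antitoneOn_sub_of_deriv_le (convex_Icc t₀ t₁) (fun t _ => hΦ t) hΨ hρ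
  have h := hanti ⟨le_rfl, ht⟩ ⟨ht, le_rfl⟩ ht
  simp only at h
  linarith

/-- Log-growth lower bound: `Φ' = ρ ≥ ρmin` on `[t₀, t₁]` gives `ρmin·(t₁ - t₀) ≤ Φ t₁ - Φ t₀`.
[folklore] -/
theorem log_growth_ge {Φ ρ : ℝ → ℝ} {t₀ t₁ ρmin : ℝ} (ht : t₀ ≤ t₁)
    (hΦ : ∀ t, HasDerivAt Φ (ρ t) t) (hρ : ∀ t ∈ Icc t₀ t₁, ρmin ≤ ρ t) :
    ρmin * (t₁ - t₀) ≤ Φ t₁ - Φ t₀ := by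
  have hΨ : ∀ t ∈ Icc t₀ t₁, HasDerivAt (fun s : ℝ => ρmin * s) ρmin t := fun t _ => by
    simpa using (hasDerivAt_id' t).const_mul ρmin
  have hmono := Thm53.monotoneOn_sub_of_le_deriv (convex_Icc t₀ t₁) (fun t _ => hΦ t) hΨ hρ
  have h := hmono ⟨le_rfl, ht⟩ ⟨ht, le_rfl⟩ ht
  simp only at h
  linarith

/-- A positive solution of `y' = ρ(t)y` with `ρ ≤ ρmax` on `[t₀, t₁]` grows at most like
`e^{ρmax (t₁ - t₀)}`. [cite: Tao2016AveragedNS, §5.3 (y-gronwall)] -/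
theorem trigger_le_of_rate_le {y ρ : ℝ → ℝ} {t₀ t₁ ρmax : ℝ} (ht : t₀ ≤ t₁)
    (hy : ∀ t, HasDerivAt y (ρ t * y t) t) (hpos : ∀ t, 0 < y t)
    (hρ : ∀ t ∈ Icc t₀ t₁, ρ t ≤ ρmax) : y t₁ ≤ y t₀ * Real.exp (ρmax * (t₁ - t₀)) := by
  have hlog : ∀ t, HasDerivAt (fun s => Real.log (y s)) (ρ t) t := by
    intro t
    refine ((hy t).log (hpos t).ne').congr_deriv ?_
    field_simp [(hpos t).ne']
  have hg := log_growth_le ht hlog hρ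
  calc y t₁ = Real.exp (Real.log (y t₁)) := (Real.exp_log (hpos _)).symm
    _ ≤ Real.exp (Real.log (y t₀) + ρmax * (t₁ - t₀)) := Real.exp_le_exp.2 (by linarith)
    _ = y t₀ * Real.exp (ρmax * (t₁ - t₀)) := by rw [Real.exp_add, Real.exp_log (hpos _)]

/-- A positive solution of `y' = ρ(t)y` with `ρ ≥ ρmin` on `[t₀, t₁]` grows at least like
`e^{ρmin (t₁ - t₀)}`. [cite: Tao2016AveragedNS, §5.3 (y-gronwall)] -/
theorem trigger_ge_of_le_rate {y ρ : ℝ → ℝ} {t₀ t₁ ρmin : ℝ} (ht : t₀ ≤ t₁)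
    (hy : ∀ t, HasDerivAt y (ρ t * y t) t) (hpos : ∀ t, 0 < y t)
    (hρ : ∀ t ∈ Icc t₀ t₁, ρmin ≤ ρ t) : y t₀ * Real.exp (ρmin * (t₁ - t₀)) ≤ y t₁ := by
  have hlog : ∀ t, HasDerivAt (fun s => Real.log (y s)) (ρ t) t := by
    intro t
    refine ((hy t).log (hpos t).ne').congr_deriv ?_
    field_simp [(hpos t).ne']
  have hg := log_growth_ge ht hlog hρ
  calc y t₀ * Real.exp (ρmin * (t₁ - t₀))
      = Real.exp (Real.log (y t₀) + ρmin * (t₁ - t₀)) := by rw [Real.exp_add, Real.exp_log (hpos _)]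
    _ ≤ Real.exp (Real.log (y t₁)) := Real.exp_le_exp.2 (by linarith)
    _ = y t₁ := Real.exp_log (hpos _)

/-- **Clocked trigger, quiet phase: no premature ignition.** If the rate is at most `δ ≥ 0` on
`[0, t₁]` (the clock is quiet) and the trigger starts at most `θe^{-m}` with `δt₁ < m`, then it stays
strictly below the threshold `θ` on `[0, t₁]` — for EVERY such initial level: the kick tolerance of a
clocked trigger is `≈ θe^{-m} ≥ θe^{-δt₁-}`, set by the clock's quietness, not by the ignition rate.
[folklore] -/
theorem clockedTrigger_lt_threshold {y ρ : ℝ → ℝ} {θ m δ t₁ t : ℝ}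
    (hy : ∀ t, HasDerivAt y (ρ t * y t) t) (hpos : ∀ t, 0 < y t) (hδ0 : 0 ≤ δ)
    (hδ : ∀ s ∈ Icc 0 t₁, ρ s ≤ δ) (h0 : y 0 ≤ θ * Real.exp (-m)) (hm : δ * t₁ < m)
    (ht : t ∈ Icc 0 t₁) : y t < θ := by
  have hθ : 0 < θ := by
    have h := (hpos 0).trans_le h0
    by_contra hθ
    have hθ' : θ ≤ 0 := le_of_not_gt hθ
    nlinarith [Real.exp_pos (-m)]
  have h1 := trigger_le_of_rate_le ht.1 hy hpos (fun s hs => hδ s ⟨hs.1, hs.2.trans ht.2⟩)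
  have h2 : δ * (t - 0) ≤ δ * t₁ := by nlinarith [ht.2]
  have h3 : Real.exp (δ * t₁ - m) < 1 := Real.exp_lt_one_iff.2 (by linarith)
  calc y t ≤ y 0 * Real.exp (δ * (t - 0)) := h1
    _ ≤ θ * Real.exp (-m) * Real.exp (δ * t₁) :=
        mul_le_mul h0 (Real.exp_le_exp.2 h2) (Real.exp_pos _).le (by positivity)
    _ = θ * Real.exp (δ * t₁ - m) := by
        rw [mul_assoc, ← Real.exp_add, show -m + δ * t₁ = δ * t₁ - m by ring]
    _ < θ * 1 := mul_lt_mul_of_pos_left h3 hθ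
    _ = θ := mul_one θ

/-- **Clocked trigger, loaded phase: ignition within the clock's width.** If the rate is `≥ 0` on
`[0, t₁ + w]` and `≥ ρ₁ > 0` on `[t₁ + w, t₁ + w + m'/ρ₁]` (the clock has stepped up by `t₁ + w`), then
from ANY initial level `≥ θe^{-m'}` the trigger is at threshold by `t₁ + w + m'/ρ₁`. With
`clockedTrigger_lt_threshold`: every seed in `[θe^{-m'}, θe^{-m}]`, `δt₁ < m ≤ m'`, fires inside
`[t₁, t₁ + w + m'/ρ₁]` — a window of the CLOCK's width when `ρ₁ ≳ m'/w`. [folklore] -/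
theorem clockedTrigger_fires_by {y ρ : ℝ → ℝ} {θ m' ρ₁ t₁ w : ℝ}
    (hy : ∀ t, HasDerivAt y (ρ t * y t) t) (hpos : ∀ t, 0 < y t) (hρ₁ : 0 < ρ₁) (hm' : 0 ≤ m')
    (ht₁w : 0 ≤ t₁ + w) (hρ0 : ∀ s ∈ Icc 0 (t₁ + w), 0 ≤ ρ s)
    (hρ : ∀ s ∈ Icc (t₁ + w) (t₁ + w + m' / ρ₁), ρ₁ ≤ ρ s) (h0 : θ * Real.exp (-m') ≤ y 0) :
    θ ≤ y (t₁ + w + m' / ρ₁) := by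
  have h1 := trigger_ge_of_le_rate ht₁w hy hpos hρ0
  simp only [zero_mul, sub_zero, Real.exp_zero, mul_one] at h1
  have hle : t₁ + w ≤ t₁ + w + m' / ρ₁ := by
    have := div_nonneg hm' hρ₁.le; linarith
  have h2 := trigger_ge_of_le_rate hle hy hpos hρ
  have h3 : ρ₁ * (t₁ + w + m' / ρ₁ - (t₁ + w)) = m' := by field_simp; ring
  rw [h3] at h2
  have h4 : θ * Real.exp (-m') * Real.exp m' = θ := by
    rw [mul_assoc, ← Real.exp_add]; simp
  calc θ = θ * Real.exp (-m') * Real.exp m' := h4.symm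
    _ ≤ y 0 * Real.exp m' := mul_le_mul_of_nonneg_right h0 (Real.exp_pos _).le
    _ ≤ y (t₁ + w) * Real.exp m' := mul_le_mul_of_nonneg_right h1 (Real.exp_pos _).le
    _ ≤ y (t₁ + w + m' / ρ₁) := h2

/-- **The sharpening law of one swept stage.** In the swept model the product (ignition time) ×
(ignition rate at firing `M·t_f`) — the clock's ramp time measured in trigger e-fold times, i.e.
the SHARPENING RATIO of the stage — is exactly `2·log(θ/c₀)`: sharpening `2m` per stage costs
seed ratio `e^{-m}`. Tao buys sharpening `2K¹⁰` in ONE stage (`m = K¹⁰`); `s` latched stages of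
`m` each would buy `(2m)^s`. [cite: Tao2016AveragedNS, §5.5 caricature (i)–(ii)] -/
theorem sharpening_eq_two_mul_log {M c₀ θ : ℝ} (hM : 0 < M) (hc : 0 < c₀) (hcθ : c₀ ≤ θ) :
    ignitionTime M c₀ θ * (M * ignitionTime M c₀ θ) = 2 * Real.log (θ / c₀) := by
  have hlog : 0 ≤ Real.log (θ / c₀) := Real.log_nonneg ((one_le_div hc).2 hcθ)
  have harg : 0 ≤ 2 * Real.log (θ / c₀) / M := by positivity
  have hsq : ignitionTime M c₀ θ ^ 2 = 2 * Real.log (θ / c₀) / M := by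
    unfold ignitionTime; exact Real.sq_sqrt harg
  calc ignitionTime M c₀ θ * (M * ignitionTime M c₀ θ) = M * ignitionTime M c₀ θ ^ 2 := by ring
    _ = 2 * Real.log (θ / c₀) := by rw [hsq]; field_simp

end Literature.Analysis.FluidPDE.Tao2016AveragedNS
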